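import Literature.Geometry.Riemannian.LevelSetFlowBalls
import HarnessLib

/-!
# Inner sphere barriers for weak set flows; the level set flow of a round sphere

Topic `Literature/Geometry/Riemannian`. Companion of `LevelSetFlowExtinction.lean` (OUTER sphere
barriers: a weak set flow inside a ball stays inside the shrinking ball) and
`LevelSetFlowBalls.lean`: here the INNER barriers (White 2000, §2; Evans–Spruck 1991, §7.1) —
a weak set flow `K` (`IsWeakSetFlowIn`, Hershkovits–White Def. 19) in `ℝⁿ⁺¹` which misses a closed
ball `B̄(x, ρ)` at time `a` misses `B̄(x, √(ρ² - 2ns))` at time `a + s` (`2ns < ρ²`): holes close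
up no faster than spheres shrink. The proof covers the smaller ball by time-`(a + s)` slices of
classical sphere flows avoided by `K` — spheres about `x` through each `y ≠ x`, and a small sphere
about a shifted centre through `x` itself (`IsWeakSetFlowIn.disjoint_sphere_sqrt`,
`ShrinkingSphereMCF.lean`). Consequences: **backward reach** (a point of `K t` lies within
`√(2n(t - s))` of `K s`), **no sudden appearance** (a weak set flow / level set flow which is
empty at time `s` stays empty), and the exact **level set flow of the round sphere**
`F_t(∂B(c, r₀)) = ∂B(c, √(r₀² - 2nt))` for `0 ≤ t < r₀²/(2n)` (Evans–Spruck 1991, (7.2)–(7.3)),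
`⊆ {c}` at the extinction time. Everything is PROVED; no definitions, no named facts.

## Contents

* `IsWeakSetFlowIn.disjoint_closedBall_sqrt` — **inner barrier**.
* `IsWeakSetFlowIn.exists_mem_dist_le` — backward reach; `IsWeakSetFlowIn.eq_empty_of_eq_empty`,
  `levelSetFlow_eq_empty_of_eq_empty` — no sudden appearance.
* `levelSetFlow_sphere` — **`F_t(∂B(c, r₀)) = ∂B(c, √(r₀² - 2nt))`**;
  `levelSetFlow_sphere_subset_singleton` — `F_T(∂B(c, r₀)) ⊆ {c}` for `2nT = r₀²`.

## References

* B. White, *The size of the singular set in mean curvature flow of mean-convex sets*, J. Amer.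
  Math. Soc. 13 (2000), §2. [White2000]
* L. C. Evans, J. Spruck, *Motion of level sets by mean curvature. I*, J. Differential Geom. 33
  (1991), §7.1, (7.2)–(7.3). [EvansSpruck1991]
* O. Hershkovits, B. White, Comm. Pure Appl. Math. 73 (2020), Appendix, Def. 19.
  [HershkovitsWhite2019]
-/

noncomputable section

open Bundle Set Function Metric Module Filter
open scoped Manifold ContDiff Topology RealInnerProductSpace ENNReal

namespace Literature.Geometry.Riemannian

open Lorentzian Lorentzian.PseudoRiemannianMetric

variable {n : ℕ}

/-! ### Inner sphere barriers: holes do not close up faster than spheres shrink -/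

section Inner

/-- **Inner barrier (White 2000, §2; Evans–Spruck 1991, §7.1).** If a weak set flow `K` misses
the closed ball `B̄(x, ρ)` at time `a`, then at time `a + s` (`0 ≤ s`, `2ns < ρ²`,
`[a, a + s] ⊆ I`, `B̄(x, ρ) ⊆ W`) it misses `B̄(x, √(ρ² - 2ns))`: every point `y ≠ x` of the
smaller ball lies on the time-`(a + s)` slice of the classical sphere flow about `x` started from
`∂B(x, √(‖y - x‖² + 2ns)) ⊆ B̄(x, ρ)`, and the centre `x` lies on a small sphere flow about a
nearby centre; all these are avoided (`IsWeakSetFlowIn.disjoint_sphere_sqrt`).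
[cite: White2000, §2] [cite: EvansSpruck1991, §7.1] -/
theorem IsWeakSetFlowIn.disjoint_closedBall_sqrt (hn : 1 ≤ n)
    {W : Set (EuclideanSpace ℝ (Fin (n + 1)))} {I : Set ℝ}
    {K : ℝ → Set (EuclideanSpace ℝ (Fin (n + 1)))}
    (hK : IsWeakSetFlowIn (euclideanMetric (EuclideanSpace ℝ (Fin (n + 1)))) W I K)
    (x : EuclideanSpace ℝ (Fin (n + 1))) {a ρ s : ℝ} (hρ : 0 < ρ) (hs : 0 ≤ s)
    (hsρ : 2 * n * s < ρ ^ 2) (hI : Icc a (a + s) ⊆ I) (hW : closedBall x ρ ⊆ W)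
    (ha : Disjoint (closedBall x ρ) (K a)) :
    Disjoint (closedBall x (Real.sqrt (ρ ^ 2 - 2 * n * s))) (K (a + s)) := by
  have hn0 : (0 : ℝ) < n := by exact_mod_cast hn
  have hns : 0 ≤ 2 * n * s := by positivity
  refine Set.disjoint_left.2 fun y hy hyK ↦ ?_
  rw [mem_closedBall, dist_eq_norm] at hy
  -- spheres of radius `≤ ρ` about `x` (and their shrinking evolutions) lie in `W` and miss `K a`
  have hsub : ∀ {c' : EuclideanSpace ℝ (Fin (n + 1))} {r : ℝ}, dist c' x + r ≤ ρ →
      ∀ r' : ℝ, 0 ≤ r' → r' ≤ r → sphere c' r' ⊆ closedBall x ρ := by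
    intro c' r hcr r' hr0 hr'r z hz
    rw [mem_sphere] at hz
    rw [mem_closedBall]
    calc dist z x ≤ dist z c' + dist c' x := dist_triangle _ _ _
      _ ≤ ρ := by linarith
  have havoid : ∀ {c' : EuclideanSpace ℝ (Fin (n + 1))} {r : ℝ}, 0 < r → dist c' x + r ≤ ρ →
      2 * n * s < r ^ 2 →
      Disjoint (sphere c' (Real.sqrt (r ^ 2 - 2 * n * s))) (K (a + s)) := by
    intro c' r hr hcr hsr
    refine hK.disjoint_sphere_sqrt hn c' hr hs hsr hI (fun t ht ↦ ?_) ?_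
    · refine (hsub hcr _ (Real.sqrt_nonneg _) ?_).trans hW
      rw [Real.sqrt_le_left hr.le]
      nlinarith [ht.1]
    · exact ha.mono_left (hsub hcr r hr.le le_rfl)
  rcases eq_or_lt_of_le (norm_nonneg (y - x)) with hd | hd
  · -- the centre: a small sphere about a shifted centre passes through `x` at time `a + s`
    have hyx : y = x := by rwa [eq_comm, norm_eq_zero, sub_eq_zero] at hd
    subst hyx
    set σ := Real.sqrt (2 * n * s) with hσ
    have hσρ : σ < ρ := by
      rw [hσ, Real.sqrt_lt' hρ]; exact hsρ
    set ε := (ρ - σ) / 2 with hε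
    have hεpos : 0 < ε := by rw [hε]; linarith
    -- a unit vector
    obtain ⟨e, he⟩ := (NormedSpace.sphere_nonempty (E := EuclideanSpace ℝ (Fin (n + 1)))
      (x := 0) (r := 1)).2 zero_le_one
    have he1 : ‖e‖ = 1 := by rwa [mem_sphere_zero_iff_norm] at he
    set c' := y + ε • e with hc'
    have hdist : dist c' y = ε := by
      rw [dist_eq_norm, hc', add_sub_cancel_left, norm_smul, he1, mul_one,
        Real.norm_of_nonneg hεpos.le]
    set r := Real.sqrt (ε ^ 2 + 2 * n * s) with hr
    have hrpos : 0 < r := Real.sqrt_pos.2 (by positivity)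
    have hrsq : r ^ 2 = ε ^ 2 + 2 * n * s := Real.sq_sqrt (by positivity)
    -- `√(ε² + 2ns) ≤ √(ε²) + √(2ns)`
    have hsqrt : ∀ {p q : ℝ}, 0 ≤ p → 0 ≤ q → Real.sqrt (p + q) ≤ Real.sqrt p + Real.sqrt q := by
      intro p q hp hq
      rw [Real.sqrt_le_left (by positivity)]
      nlinarith [Real.sq_sqrt hp, Real.sq_sqrt hq, Real.sqrt_nonneg p, Real.sqrt_nonneg q]
    have hrle : r ≤ ε + σ :=
      calc r = Real.sqrt (ε ^ 2 + 2 * n * s) := rfl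
        _ ≤ Real.sqrt (ε ^ 2) + Real.sqrt (2 * n * s) := hsqrt (sq_nonneg ε) hns
        _ = ε + σ := by rw [Real.sqrt_sq hεpos.le]
    have hcr : dist c' y + r ≤ ρ := by rw [hdist, hε] at *; linarith
    have h := havoid hrpos hcr (by rw [hrsq]; nlinarith)
    rw [hrsq, add_sub_cancel_right, Real.sqrt_sq hεpos.le] at h
    refine Set.disjoint_left.1 h ?_ hyK
    rw [mem_sphere, dist_comm, hdist]
  · -- off the centre: the sphere about `x` through `y` at time `a + s`
    set d := ‖y - x‖ with hdd
    set r := Real.sqrt (d ^ 2 + 2 * n * s) with hr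
    have hrpos : 0 < r := Real.sqrt_pos.2 (by positivity)
    have hrsq : r ^ 2 = d ^ 2 + 2 * n * s := Real.sq_sqrt (by positivity)
    have hdR : d ^ 2 ≤ ρ ^ 2 - 2 * n * s := by
      have h := pow_le_pow_left₀ (norm_nonneg _) hy 2
      rwa [Real.sq_sqrt (by linarith)] at h
    have hrρ : r ≤ ρ := by
      rw [hr, Real.sqrt_le_left hρ.le]; linarith
    have hcr : dist x x + r ≤ ρ := by rw [dist_self, zero_add]; exact hrρ
    have h := havoid hrpos hcr (by rw [hrsq]; nlinarith)
    rw [hrsq, add_sub_cancel_right, Real.sqrt_sq hd.le] at h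
    refine Set.disjoint_left.1 h ?_ hyK
    rw [mem_sphere, dist_eq_norm]

/-- **Backward reach of weak set flows**: if `x ∈ K t` and `s ≤ t` (`[s, t] ⊆ I`), then `K s`
meets every closed ball `B̄(x, ρ)` with `ρ² > 2n(t - s)` contained in `W` — points of the flow at
time `t` were within `√(2n(t - s))` of the flow at time `s` (contrapositive of the inner barrier).
[cite: White2000, §2] -/
theorem IsWeakSetFlowIn.exists_mem_dist_le (hn : 1 ≤ n)
    {W : Set (EuclideanSpace ℝ (Fin (n + 1)))} {I : Set ℝ}
    {K : ℝ → Set (EuclideanSpace ℝ (Fin (n + 1)))}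
    (hK : IsWeakSetFlowIn (euclideanMetric (EuclideanSpace ℝ (Fin (n + 1)))) W I K)
    {s t : ℝ} (hst : s ≤ t) (hI : Icc s t ⊆ I) {x : EuclideanSpace ℝ (Fin (n + 1))}
    (hx : x ∈ K t) {ρ : ℝ} (hρpos : 0 < ρ) (hρ : 2 * n * (t - s) < ρ ^ 2)
    (hW : closedBall x ρ ⊆ W) :
    ∃ y ∈ K s, dist y x ≤ ρ := by
  by_contra hne
  push Not at hne
  have hdis : Disjoint (closedBall x ρ) (K s) :=
    Set.disjoint_left.2 fun y hy hyK ↦ absurd (mem_closedBall.1 hy) (not_le.2 (hne y hyK))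
  have h := hK.disjoint_closedBall_sqrt hn x hρpos (sub_nonneg.2 hst) hρ
    (by rwa [add_sub_cancel]) hW hdis
  rw [add_sub_cancel] at h
  exact Set.disjoint_left.1 h (mem_closedBall_self (Real.sqrt_nonneg _)) hx

/-- **No sudden appearance**: a weak set flow in `ℝⁿ⁺¹` which is empty at time `s` is empty at
all later times `t` with `[s, t] ⊆ I`. [cite: White2000, §2] -/
theorem IsWeakSetFlowIn.eq_empty_of_eq_empty (hn : 1 ≤ n) {I : Set ℝ}
    {K : ℝ → Set (EuclideanSpace ℝ (Fin (n + 1)))}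
    (hK : IsWeakSetFlowIn (euclideanMetric (EuclideanSpace ℝ (Fin (n + 1)))) univ I K)
    {s t : ℝ} (hst : s ≤ t) (hI : Icc s t ⊆ I) (hKs : K s = ∅) : K t = ∅ := by
  have hn0 : (0 : ℝ) < n := by exact_mod_cast hn
  refine Set.eq_empty_of_forall_notMem fun x hx ↦ ?_
  obtain ⟨y, hy, -⟩ := hK.exists_mem_dist_le hn hst hI hx
    (ρ := Real.sqrt (2 * n * (t - s)) + 1) (by positivity) (by
      have h0 : 0 ≤ 2 * n * (t - s) := by nlinarith [sub_nonneg.2 hst]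
      nlinarith [Real.sq_sqrt h0, Real.sqrt_nonneg (2 * n * (t - s))]) (subset_univ _)
  rw [hKs] at hy
  exact hy

/-- Hence **the level set flow, once empty, stays empty**: `F_s(K₀) = ∅`, `0 ≤ s ≤ t` imply
`F_t(K₀) = ∅`. [cite: White2000, §2] -/
theorem levelSetFlow_eq_empty_of_eq_empty (hn : 1 ≤ n) {K₀ : Set (EuclideanSpace ℝ (Fin (n + 1)))}
    {s t : ℝ} (hs : 0 ≤ s) (hst : s ≤ t)
    (hKs : levelSetFlow (euclideanMetric (EuclideanSpace ℝ (Fin (n + 1)))) K₀ s = ∅) :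
    levelSetFlow (euclideanMetric (EuclideanSpace ℝ (Fin (n + 1)))) K₀ t = ∅ := by
  refine Set.eq_empty_of_forall_notMem fun x hx ↦ ?_
  obtain ⟨-, K, hK, hK0, hxK⟩ := hx
  have hKs' : K s = ∅ := Set.eq_empty_of_forall_notMem fun y hy ↦ by
    have : y ∈ levelSetFlow (euclideanMetric (EuclideanSpace ℝ (Fin (n + 1)))) K₀ s :=
      subset_levelSetFlow hK hK0 hs hy
    rw [hKs] at this
    exact this
  have h := hK.eq_empty_of_eq_empty hn hst (fun r hr ↦ hs.trans hr.1) hKs'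
  rw [h] at hxK
  exact hxK

end Inner

/-! ### The level set flow of a round sphere is the shrinking sphere -/

section Sphere

/-- **The level set flow of the round sphere is exactly the shrinking sphere** before the
extinction time: for `n ≥ 1`, `r₀ > 0`, `0 ≤ t`, `2nt < r₀²`,

  `F_t(∂B(c, r₀)) = ∂B(c, √(r₀² - 2nt))`.

`⊇` is `sphere_subset_levelSetFlow_sphere` (the classical sphere flow is a weak set flow); `⊆`:
the flow lies in the shrinking closed ball (`levelSetFlow_closedBall_subset`, outer barriers) and
misses its interior (inner barriers `disjoint_closedBall_sqrt` from `B̄(c, ρ)`, `ρ < r₀`).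
Evans–Spruck 1991, §7.1, (7.2)–(7.3). [cite: EvansSpruck1991, §7.1 (7.2)–(7.3)] -/
theorem levelSetFlow_sphere (hn : 1 ≤ n) (c : EuclideanSpace ℝ (Fin (n + 1))) {r₀ : ℝ}
    (hr₀ : 0 < r₀) {t : ℝ} (ht0 : 0 ≤ t) (ht : 2 * n * t < r₀ ^ 2) :
    levelSetFlow (euclideanMetric (EuclideanSpace ℝ (Fin (n + 1)))) (sphere c r₀) t =
      sphere c (Real.sqrt (r₀ ^ 2 - 2 * n * t)) := by
  have hn0 : (0 : ℝ) < n := by exact_mod_cast hn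
  refine Subset.antisymm (fun x hx ↦ ?_) (sphere_subset_levelSetFlow_sphere hn c hr₀ ht0 ht)
  -- outer bound
  have hout : ‖x - c‖ ≤ Real.sqrt (r₀ ^ 2 - 2 * n * t) := mem_closedBall_iff_norm.1
    (levelSetFlow_closedBall_subset hn c hr₀.le ht.le (levelSetFlow_mono sphere_subset_closedBall t hx))
  rw [mem_sphere, dist_eq_norm]
  refine le_antisymm hout ?_
  by_contra hin
  rw [not_le] at hin
  -- inner bound: an initial ball `B̄(c, ρ)`, `ρ < r₀`, missed by the sphere, whose evolution contains `x`
  obtain ⟨-, K, hK, hK0, hxK⟩ := hx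
  have hd0 : 0 ≤ ‖x - c‖ := norm_nonneg _
  have hlt : ‖x - c‖ ^ 2 + 2 * n * t < r₀ ^ 2 := by
    have h := (Real.lt_sqrt hd0).1 hin
    linarith
  obtain ⟨m, hm1, hm2⟩ := exists_between hlt
  have hm0 : 0 < m := by nlinarith [sq_nonneg ‖x - c‖]
  set ρ := Real.sqrt m with hρ
  have hρpos : 0 < ρ := Real.sqrt_pos.2 hm0
  have hρsq : ρ ^ 2 = m := Real.sq_sqrt hm0.le
  have hρr₀ : ρ < r₀ := by
    rw [hρ, Real.sqrt_lt' hr₀]; exact hm2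
  have hdis : Disjoint (closedBall c ρ) (K 0) := by
    refine Set.disjoint_left.2 fun y hy hyK ↦ ?_
    have h1 := hK0 hyK
    rw [mem_sphere] at h1
    rw [mem_closedBall, h1] at hy
    linarith
  have h := hK.disjoint_closedBall_sqrt hn c hρpos ht0 (by rw [hρsq]; nlinarith [sq_nonneg ‖x - c‖])
    (fun r hr ↦ hr.1) (subset_univ _) hdis
  rw [zero_add] at h
  refine Set.disjoint_left.1 h ?_ hxK
  rw [mem_closedBall, dist_eq_norm, hρsq, ← Real.sqrt_sq hd0]
  exact Real.sqrt_le_sqrt (by linarith)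

/-- At the extinction time only the centre can survive: `F_T(∂B(c, r₀)) ⊆ {c}` for `2nT = r₀²`.
[cite: EvansSpruck1991, §7.1 (7.2)] -/
theorem levelSetFlow_sphere_subset_singleton (hn : 1 ≤ n) (c : EuclideanSpace ℝ (Fin (n + 1)))
    {r₀ : ℝ} (hr₀ : 0 < r₀) {t : ℝ} (ht : 2 * n * t = r₀ ^ 2) :
    levelSetFlow (euclideanMetric (EuclideanSpace ℝ (Fin (n + 1)))) (sphere c r₀) t ⊆ {c} := by
  intro x hx
  have h := levelSetFlow_closedBall_subset hn c hr₀.le ht.le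
    (levelSetFlow_mono sphere_subset_closedBall t hx)
  rw [← ht, sub_self, Real.sqrt_zero, closedBall_zero] at h
  exact h

end Sphere

end Literature.Geometry.Riemannian

end
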